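import Summits.BirchSwinnertonDyer.Rank1Residual.Additive.RamifiedSevenGenusIwasawaCharacterEvaluation
import HarnessLib

set_option autoImplicit false

/-!
# `𝒞₇` genus road (crux `EllipticUnitValueSevenOfGZK`, K7r), a (T-R) prerequisite: RAMANUJAN AVERAGING of the evaluation character
# `ρ_{ι₇,ζ}` over the unit residues of one level lands in `ι₇(ℤ₇)`

Cell bsd-cm, seat bsd-cm-k-ty1 g36 (literature-prover; explicit unit, claim-free), OFFER (C) of 2026-08-31 (STATUS l.4410) for the unseated
rigidity row (T-R) `GenusSeven.unitLaw_position_rigid` (pen bsd-cm-plan g39 D1172 (3), sketch `bsd-cm-plan/g39/skel/TR.sketch.lean`; critic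
idea-crit-15 NOTE #31/#42).  PURE KERNEL (theorems only): no named fact, no `sorry`, no `instance`, no notation; (K-1)
`RamifiedSevenGenusIwasawaCharacterEvaluation.lean` (p823136) untouched.

THE STEP IT SERVES.  In (T-R), two solutions of the ★-value law give `ρ_χ(g) = C` (`g := uStar′·uStar⁻¹ ∈ Λˣ`, ONE complex constant `C`)
for every good primitive layer character `χ` of large level; before (M-CANCEL) (`exists_level_forall_charEval_ne_zero`) can be applied to
`7^m·(g − c)` one needs `C ∈ ι₇(ℚ₇)`.  Summing `ρ_{χ^s}(g)` over the `φ(7^{n+1})` primitive characters of ONE level does it: with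
`ρ_{ι₇,ζ}(g) = r(ζ − 1)` for a polynomial `r ≡ g (mod ω_{n+1})` (`evalHom_eq_eval₂`),
`∑_{s ∈ (ℤ/7^{n+1})ˣ} r(ζ^s − 1) = ∑_j r_j ∑_s (ζ^s − 1)^j = ∑_j r_j ∑_i (−1)^{j−i} C(j,i) ∑_s ζ^{si}`, and each
`∑_{s ∈ (ℤ/7^{n+1})ˣ} ζ^{si}` is a RAMANUJAN SUM `c_{7^{n+1}}(i) ∈ ℤ` — here obtained without its closed form as
`∑_{s < 7^{n+1}} ω^s − ∑_{t < 7^n} (ω^7)^t`, `ω := ζ^i`, each complete geometric sum over a full period of a root of unity being an integer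
(`N` if `ω = 1`, else `0`).  Hence `∑_s ρ_{ι₇,ζ^s}(g) = ι₇(c)` with `c ∈ ℤ₇`, so `φ(7^{n+1})·C ∈ ι₇(ℤ₇)`.

## Contents (namespace `GenusSeven.CharacterEvaluation`)
* `exists_int_geom_sum_eq` — `ω^N = 1 ⇒ ∑_{s<N} ω^s ∈ ℤ`;
* `exists_int_sum_units_pow_eq` — `ω^{7^{n+1}} = 1 ⇒ ∑_{s<7^{n+1}, 7∤s} ω^s ∈ ℤ`;
* `exists_int_sum_units_sub_one_pow_eq` — `ζ^{7^{n+1}} = 1 ⇒ ∑_{s<7^{n+1}, 7∤s} (ζ^s − 1)^j ∈ ℤ`;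
* ★ `exists_padicInt_sum_units_evalHom_eq` — `ζ^{7^{n+1}} = 1 ⇒ ∃ c : ℤ₇, ∑_{s<7^{n+1}, 7∤s} ρ_{ι₇,ζ^s}(g) = ι₇(c)` for every `g ∈ Λ`.

HONEST LABEL: kernel algebra; nothing about zeta values or BSD; no stub closed; (T-R) itself is NOT typed here (its other prerequisites —
Hecke-side non-vanishing, layer-character and depleted-`L` existence, `Φ.Ω ≠ 0` — are listed on the cell STATUS of 2026-08-31);
stmt-BirchSwinnertonDyer-19945 stays OPEN; no summit statement is proved by this seat; BSD is claimed for no curve.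

## References
* L. Washington, *Introduction to Cyclotomic Fields* (1997), §7.1–7.2 (Iwasawa algebra and `ω_n`), Lemma 4.7-type character sums. [Washington1997]
* S. Lang, *Cyclotomic Fields I and II* (1990), Ch. 5 §1 Thm. 1.1. [Lang1990]
* Tree: (K-1) `Additive/RamifiedSevenGenusIwasawaCharacterEvaluation.lean` (p823136: `evalHom`, `evalHom_eq_eval₂`,
  `exists_level_forall_charEval_ne_zero`); `IwasawaH1Exists.exists_polynomial_sub_coe_mem_span`.
-/

noncomputable section

open scoped NumberField
open Polynomial Finset
open Literature.NumberTheory.GaloisRepresentations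
open Literature.NumberTheory.EllipticCurves
open Literature.NumberTheory.EllipticCurves.Rank1Residual
open Literature.NumberTheory.EllipticCurves.IwasawaAlgebra
open Literature.NumberTheory.EllipticCurves.Kato2004
open Summit.BirchSwinnertonDyer.Rank1Residual

namespace Summit.BirchSwinnertonDyer.Rank1Residual.Additive.GenusSeven

namespace CharacterEvaluation

/-- A complete geometric sum of a root of unity over a full period is an integer (`N` if `ω = 1`, else `0`). [cite: Washington1997, §7.1] -/
theorem exists_int_geom_sum_eq {ω : ℂ} {N : ℕ} (hω : ω ^ N = 1) : ∃ z : ℤ, ∑ s ∈ range N, ω ^ s = z := by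
  by_cases h1 : ω = 1
  · exact ⟨N, by simp [h1]⟩
  · refine ⟨0, ?_⟩
    have h := geom_sum_mul ω N
    rw [hω, sub_self, mul_eq_zero, sub_eq_zero] at h
    rcases h with h | h
    · rw [h, Int.cast_zero]
    · exact absurd h h1

/-- The sum of `ω^s` over the unit residues `s (mod 7^{n+1})` is an integer when `ω^{7^{n+1}} = 1` (a Ramanujan sum:
all residues minus the multiples of `7`). [cite: Washington1997, §7.1] -/
theorem exists_int_sum_units_pow_eq {ω : ℂ} {n : ℕ} (hω : ω ^ 7 ^ (n + 1) = 1) :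
    ∃ z : ℤ, ∑ s ∈ (range (7 ^ (n + 1))).filter (fun s ↦ ¬ 7 ∣ s), ω ^ s = z := by
  obtain ⟨z₁, hz₁⟩ := exists_int_geom_sum_eq hω
  have hω7 : (ω ^ 7) ^ 7 ^ n = 1 := by rw [← pow_mul, ← pow_succ', hω]
  obtain ⟨z₂, hz₂⟩ := exists_int_geom_sum_eq hω7
  refine ⟨z₁ - z₂, ?_⟩
  have hsplit := Finset.sum_filter_add_sum_filter_not (range (7 ^ (n + 1))) (fun s ↦ 7 ∣ s) (fun s ↦ ω ^ s)
  have hset : (range (7 ^ (n + 1))).filter (fun s ↦ 7 ∣ s) =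
      (range (7 ^ n)).map ⟨(7 * ·), mul_right_injective₀ (by norm_num)⟩ := by
    ext s
    simp only [mem_filter, mem_range, mem_map, Function.Embedding.coeFn_mk]
    constructor
    · rintro ⟨hs, t, rfl⟩
      refine ⟨t, ?_, rfl⟩
      rw [pow_succ] at hs
      omega
    · rintro ⟨t, ht, rfl⟩
      refine ⟨?_, t, rfl⟩
      rw [pow_succ]
      omega
  have hdiv : ∑ s ∈ (range (7 ^ (n + 1))).filter (fun s ↦ 7 ∣ s), ω ^ s = ∑ t ∈ range (7 ^ n), (ω ^ 7) ^ t := by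
    rw [hset, Finset.sum_map]
    simp only [Function.Embedding.coeFn_mk, pow_mul]
  rw [hdiv, hz₂, hz₁] at hsplit
  rw [Int.cast_sub, ← hsplit]
  ring

/-- The sum of `(ζ^s − 1)^j` over the unit residues `s (mod 7^{n+1})` is an integer when `ζ^{7^{n+1}} = 1` (binomial expansion and the
previous lemma at `ω := ζ^i`). [cite: Washington1997, §7.1] -/
theorem exists_int_sum_units_sub_one_pow_eq {ζ : ℂ} {n : ℕ} (hζ : ζ ^ 7 ^ (n + 1) = 1) (j : ℕ) :
    ∃ z : ℤ, ∑ s ∈ (range (7 ^ (n + 1))).filter (fun s ↦ ¬ 7 ∣ s), (ζ ^ s - 1) ^ j = z := by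
  have hexp : ∀ s : ℕ, (ζ ^ s - 1) ^ j = ∑ m ∈ range (j + 1), (ζ ^ m) ^ s * ((-1) ^ (j - m) * (j.choose m : ℂ)) := by
    intro s
    rw [sub_eq_add_neg, add_pow]
    refine Finset.sum_congr rfl fun m _ ↦ ?_
    rw [← pow_mul, mul_comm s m, pow_mul]
    ring
  simp_rw [hexp]
  rw [Finset.sum_comm]
  have hm : ∀ m ∈ range (j + 1), ∃ z : ℤ,
      ∑ s ∈ (range (7 ^ (n + 1))).filter (fun s ↦ ¬ 7 ∣ s), (ζ ^ m) ^ s * ((-1) ^ (j - m) * (j.choose m : ℂ)) = z := by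
    intro m _
    have hωm : (ζ ^ m) ^ 7 ^ (n + 1) = 1 := by rw [← pow_mul, mul_comm, pow_mul, hζ, one_pow]
    obtain ⟨z, hz⟩ := exists_int_sum_units_pow_eq hωm
    refine ⟨z * ((-1) ^ (j - m) * (j.choose m : ℤ)), ?_⟩
    rw [← Finset.sum_mul, hz]
    push_cast
    ring
  choose! z hz using hm
  refine ⟨∑ m ∈ range (j + 1), z m, ?_⟩
  rw [Int.cast_sum]
  exact Finset.sum_congr rfl fun m hm' ↦ hz m hm'

/-- ★ **Ramanujan averaging of the evaluation character lands in `ι₇(ℤ₇)`**: for `ζ ∈ ℂ` with `ζ^{7^{n+1}} = 1` and every `g ∈ Λ`,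
`∑_{s < 7^{n+1}, 7 ∤ s} ρ_{ι₇,ζ^s}(g) = ι₇(c)` for some `c ∈ ℤ₇` (module docstring).  The proofs `hζs s` of `∃ m, (ζ^s)^{7^m} = 1` are
arbitrary (the value of `evalHom` does not depend on them). [cite: Washington1997, §7.1 and Prop. 7.2] [cite: Lang1990, Ch. 5 §1 Thm. 1.1] -/
theorem exists_padicInt_sum_units_evalHom_eq (ι₇ : ℚ_[7] →+* ℂ) {ζ : ℂ} {n : ℕ} (hζ : ζ ^ 7 ^ (n + 1) = 1)
    (hζs : ∀ s : ℕ, ∃ m : ℕ, (ζ ^ s) ^ 7 ^ m = 1) (g : IwasawaAlgebra 7) :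
    ∃ c : ℤ_[7], ∑ s ∈ (range (7 ^ (n + 1))).filter (fun s ↦ ¬ 7 ∣ s), evalHom ι₇ (ζ ^ s) (hζs s) g = ι₇ (c : ℚ_[7]) := by
  obtain ⟨r, hr⟩ := IwasawaH1Exists.exists_polynomial_sub_coe_mem_span 7 (n + 1) g
  have hs7 : ∀ s : ℕ, (ζ ^ s) ^ 7 ^ (n + 1) = 1 := fun s ↦ by rw [← pow_mul, mul_comm, pow_mul, hζ, one_pow]
  have hev : ∀ s : ℕ, evalHom ι₇ (ζ ^ s) (hζs s) g =
      ∑ i ∈ range (r.natDegree + 1), ι₇ ((r.coeff i : ℤ_[7]) : ℚ_[7]) * (ζ ^ s - 1) ^ i := fun s ↦ by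
    rw [evalHom_eq_eval₂ ι₇ (ζ ^ s) (hζs s) (hs7 s) hr, eval₂_eq_sum_range]
    rfl
  simp_rw [hev]
  rw [Finset.sum_comm]
  have hi : ∀ i ∈ range (r.natDegree + 1), ∃ z : ℤ,
      ∑ s ∈ (range (7 ^ (n + 1))).filter (fun s ↦ ¬ 7 ∣ s), ι₇ ((r.coeff i : ℤ_[7]) : ℚ_[7]) * (ζ ^ s - 1) ^ i =
        ι₇ ((r.coeff i : ℤ_[7]) : ℚ_[7]) * z := by
    intro i _
    obtain ⟨z, hz⟩ := exists_int_sum_units_sub_one_pow_eq hζ i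
    exact ⟨z, by rw [← Finset.mul_sum, hz]⟩
  choose! z hz using hi
  refine ⟨∑ i ∈ range (r.natDegree + 1), r.coeff i * (z i : ℤ_[7]), ?_⟩
  rw [Finset.sum_congr rfl fun i hi' ↦ hz i hi']
  simp only [PadicInt.coe_sum, PadicInt.coe_mul, PadicInt.coe_intCast, map_sum, map_mul, map_intCast]

end CharacterEvaluation

end Summit.BirchSwinnertonDyer.Rank1Residual.Additive.GenusSeven

end
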